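import Literature.AlgebraicGeometry.HodgeTheory.LefschetzOneOneOfKodairaSerre
import Literature.AlgebraicGeometry.HodgeTheory.KodairaSerreSectionsAllDim
import Literature.AlgebraicGeometry.HodgeTheory.HodgeClassesDimLEThreeOfGAGA
import Literature.AlgebraicGeometry.HodgeTheory.HardLefschetzNFoldHolds
import HarnessLib

/-!
# The Lefschetz theorem on `(1,1)`-classes and the Hodge conjecture in dimension `≤ 3`: discharges

Proof file (leaf) for the two named facts of `LefschetzOneOne`:

* `lefschetzOneOne_rational` (C. Voisin, *Hodge Theory and Complex Algebraic Geometry I* (2002),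
  Thm. 11.30 in its rational form, §11.3.2): every rational `(1,1)`-class on a smooth complex
  projective variety is algebraic. The tree proves it from the Kodaira–Serre existence of a
  non-identically-vanishing holomorphic section after an algebraic twist
  (`lefschetzOneOne_rational_of_kodairaSerre_fact`, file `LefschetzOneOneOfKodairaSerre`: exponential
  sequence / Čech integrality, `c = a · ch(L)`, divisor of a meromorphic section, Chow), and that
  existence statement is now the theorem `kodairaSerre_exists_globalSection_algebraicTwist_holds`
  (file `KodairaSerreSectionsAllDim`, Serre's dimension count, GAGA n° 16 Lemme 8).
* `hodgeClasses_algebraic_of_dim_le_three` (Voisin II, proof of Prop. 10.26): the Hodge conjecture in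
  every degree for smooth complex projective varieties of dimension `≤ 3` — from Lefschetz `(1,1)` and
  hard Lefschetz for threefolds (`hodgeClasses_algebraic_of_dim_le_three_of_nFold`, file
  `HodgeClassesDimLEThreeOfGAGA`), the latter being the theorem `nonempty_hardLefschetzNFold_holds`
  (file `HardLefschetzNFoldHolds`).

This file only composes these theorems of the tree; it is a separate leaf so that the (heavy,
mutually independent) import cones of the Kodaira–Serre count and of hard Lefschetz meet only here.

## References

* C. Voisin, *Hodge Theory and Complex Algebraic Geometry I* (2002), Thm. 11.30, Cor. 11.34,
  §11.3.2, Thm. 6.25. [VoisinHodgeI2002]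
* C. Voisin, *Hodge Theory and Complex Algebraic Geometry II* (2003), §10.2.3, proof of Prop. 10.26.
  [VoisinHodgeII2003]
* J.-P. Serre, *Géométrie algébrique et géométrie analytique*, Ann. Inst. Fourier 6 (1956), n° 16
  Lemme 8. [SerreGAGA1956]
-/

namespace Literature.AlgebraicGeometry.HodgeTheory

/-- **The Lefschetz theorem on `(1,1)`-classes, rational form (Voisin I, Thm. 11.30), discharged**:
for `X` smooth projective over `ℂ`, every rational class of Hodge type `(1,1)` in `H²(X(ℂ); ℂ)` is
algebraic — by `lefschetzOneOne_rational_of_kodairaSerre_fact` (Voisin's proof of Thm. 11.30 with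
Cor. 11.34) applied to the theorem `kodairaSerre_exists_globalSection_algebraicTwist_holds`.
[cite: VoisinHodgeI2002, Thm. 11.30, Cor. 11.34 (proof) and §11.3.2] [cite: SerreGAGA1956, n° 16 Lemme 8] -/
theorem lefschetzOneOne_rational_holds : lefschetzOneOne_rational :=
  lefschetzOneOne_rational_of_kodairaSerre_fact kodairaSerre_exists_globalSection_algebraicTwist_holds

/-- **The Hodge conjecture in every degree for smooth complex projective varieties of dimension
`≤ 3` (Voisin II, proof of Prop. 10.26), discharged**: Lefschetz `(1,1)`
(`lefschetzOneOne_rational_holds`) and hard Lefschetz for threefolds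
(`nonempty_hardLefschetzNFold_holds 3`), assembled by `hodgeClasses_algebraic_of_dim_le_three_of_nFold`.
[cite: VoisinHodgeII2003, §10.2.3 proof of Prop. 10.26] [cite: VoisinHodgeI2002, Thm. 6.25 and Thm. 11.30] -/
theorem hodgeClasses_algebraic_of_dim_le_three_holds : hodgeClasses_algebraic_of_dim_le_three :=
  hodgeClasses_algebraic_of_dim_le_three_of_nFold lefschetzOneOne_rational_holds
    fun X ↦ nonempty_hardLefschetzNFold_holds 3 X

/-- **The Hodge conjecture for curves, surfaces and threefolds in the summit layer's spelling,
unconditionally**: `HodgeConjectureFor n X` for every smooth projective `X/ℂ` of dimension `n ≤ 3`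
(the anti-vacuity conjunct by `nonempty_hodgeModel_holds`).
[cite: VoisinHodgeII2003, §10.2.3 proof of Prop. 10.26] [cite: Deligne2000, §1] -/
theorem hodgeConjectureFor_of_dim_le_three_holds {n : ℕ} {X : Motives.SchemeOver ℂ} (hn : n ≤ 3)
    (hX : Motives.IsSmoothProjective n X) : HodgeConjectureFor n X :=
  hodgeConjectureFor_of_dim_le_three hodgeClasses_algebraic_of_dim_le_three_holds
    nonempty_hodgeModel_holds hn hX

end Literature.AlgebraicGeometry.HodgeTheory
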